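import Summits.KontsevichZagierPeriods.KontsevichZagierPeriods.Theses.DimensionBudget
import Literature.NumberTheory.Transcendental.KZCubicalCalculus

/-!
# `BudgetThesisOfSubs` (stmt-KontsevichZagierPeriods-18188, route DimensionBudget) — proof

`BudgetThesisOfSubs : CubeNashNormalForm → CubicalKernelWithinOne → BudgetThesis` is the split glue of
the deciding crux `BudgetThesis` (stmt-KontsevichZagierPeriods-3748) of route DimensionBudget into the
shared compilation crux `CubeNashNormalForm` (every difference of KZ-rational representations is
KZ-equivalent to a `ℤ`-combination of cube–Nash representations `∫_{[0,1]^{n_i}} g_i`, `g_i`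
`ℚ`-semialgebraic and real-analytic near the closed cube) and the route's budget statement on the
cubical sector `CubicalKernelWithinOne` (a vanishing `ℤ`-combination of tame cubes of dimensions `≤ K`
is a truncated relation inside dimension `K + 1`).

Proof. Given KZ-rational `r`, `r'` with equal values, compile `[r] − [r']` to a `ℤ`-combination `x`
of cube–Nash representations; replace each cube–Nash representation `s` by the tame representation
`t = [[0,1]^j, g]` of its Nash extension INSIDE ITS OWN DIMENSION by two integrand-additivity
instances (`[s] − [t] − [z]` with `z = (cube, 0)`, minus `[z] − [z] − [z]`), getting `y` in the tame
cubical span of dimension `≤ K :=` the top cube dimension with `x − y ∈ KZ.relationsLE K`; soundness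
(`KZ.relations_le_ker_eval_holds`) gives `eval y = eval x = eval ([r] − [r']) = 0`;
`CubicalKernelWithinOne` puts `y` in `relationsLE (K + 1)`; exhaustion
(`KZ.mem_relations_iff_exists_mem_relationsLE`) puts the compilation relation in some
`relationsLE d₁`; monotonicity (`KZ.relationsLE_mono`) gives `[r] − [r'] ∈ relationsLE (max d₁ (K+1))`,
which is `BudgetThesis` (its inlined truncation is `KZ.relationsLE` by `rfl`). Strategist-proved glue
(`Cruxes/BudgetThesis/GlueProof.lean`), landed by lead c10 of crux stmt-KontsevichZagierPeriods-9129
(banking). Sources: M. Kontsevich, D. Zagier, *Periods* (2001), §1.2; J. Ayoub, Ann. of Math. 181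
(2015), Rem. 1.2/1.5.
-/

open Literature.NumberTheory.Transcendental

namespace Summit.KontsevichZagierPeriods.DimensionBudget

/-- **Tame-ification inside the same dimension.** A cube–Nash representation `s` (domain the closed
unit cube written `Set.pi univ (Icc 0 1)`, integrand agreeing ON THE CUBE with a function `g` that is
`ℚ`-semialgebraic and real-analytic on a neighbourhood `U` of the cube) differs from some tame cube
representation (namely `[[0,1]^j, g]`) by a truncated relation inside dimension `j`: one
integrand-additivity instance `[s] − [t] − [z]` with `z = (cube, 0)` (`s.integrand = g + 0` on the cube)
minus the instance `[z] − [z] − [z]` (`0 = 0 + 0`). [folklore] -/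
theorem exists_isTameCube_sub_mem_relationsLE {j : ℕ} (s : KZ.IntegralRep j) (g : (Fin j → ℝ) → ℝ)
    (U : Set (Fin j → ℝ)) (hsub : Set.pi Set.univ (fun _ : Fin j => Set.Icc (0:ℝ) 1) ⊆ U)
    (hsa : IsSemialgebraicFunOn ℚ U g) (han : AnalyticOnNhd ℝ g U)
    (hdom : s.domain = Set.pi Set.univ (fun _ : Fin j => Set.Icc (0:ℝ) 1))
    (hint : ∀ z ∈ Set.pi Set.univ (fun _ : Fin j => Set.Icc (0:ℝ) 1), s.integrand z = g z) :
    ∃ t : KZ.IntegralRep j, t.IsTameCube ∧ KZ.of s - KZ.of t ∈ KZ.relationsLE j := by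
  have hcube : KZ.cube j = Set.pi Set.univ (fun _ : Fin j => Set.Icc (0:ℝ) 1) := KZ.cube_eq_pi j
  have hsubc : KZ.cube j ⊆ U := fun x hx => hsub (hcube ▸ hx)
  have hg_an : AnalyticOnNhd ℝ g (KZ.cube j) := han.mono hsubc
  have hg_sa : IsSemialgebraicFunOn ℚ (KZ.cube j) g := hsa.mono hsubc KZ.isSemialgebraic_cube
  -- the tame representation `[[0,1]^j, g]`
  obtain ⟨t, ht, htdom, htint⟩ : ∃ t : KZ.IntegralRep j, t.IsTameCube ∧ t.domain = KZ.cube j ∧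
      t.integrand = g :=
    ⟨KZ.IntegralRep.tameCube g hg_an hg_sa, KZ.IntegralRep.isTameCube_tameCube g hg_an hg_sa, rfl, rfl⟩
  -- the zero representation on the same domain
  obtain ⟨z, hzdom, hzint⟩ : ∃ z : KZ.IntegralRep j, z.domain = s.domain ∧ z.integrand = 0 :=
    ⟨{ domain := s.domain
       integrand := 0
       isSemialgebraic_domain := s.isSemialgebraic_domain
       isSemialgebraicFunOn_integrand :=
         (isSemialgebraicFunOn_aeval s.isSemialgebraic_domain 0).congr fun x _ => by simp
       integrableOn := MeasureTheory.integrableOn_zero }, rfl, rfl⟩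
  refine ⟨t, ht, ?_⟩
  -- move (1b): `[s] − [t] − [z]` is an integrand-additivity instance (`f = g + 0` on the cube)
  have h1 : KZ.of s - KZ.of t - KZ.of z ∈ KZ.integrandAddRel := by
    refine ⟨j, s, t, z, by rw [htdom, hdom, hcube], hzdom, fun x hx => ?_, rfl⟩
    rw [Pi.add_apply, htint, hzint, Pi.zero_apply, add_zero]
    exact hint x (hdom ▸ hx)
  -- move (1b): `[z] − [z] − [z]` (`0 = 0 + 0`)
  have h2 : KZ.of z - KZ.of z - KZ.of z ∈ KZ.integrandAddRel :=
    ⟨j, z, z, z, rfl, rfl, fun x _ => by rw [Pi.add_apply, hzint, Pi.zero_apply, add_zero], rfl⟩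
  -- both instances are supported in dimension `≤ j`
  have hmem : ∀ u : KZ.IntegralRep j, KZ.of u ∈ KZ.formalRepLE j := fun u =>
    KZ.of_mem_formalRepLE u le_rfl
  have h1' : KZ.of s - KZ.of t - KZ.of z ∈ KZ.relationsLE j :=
    KZ.movesLE_subset_relationsLE j
      ⟨Or.inl (Or.inl (Or.inr h1)), sub_mem (sub_mem (hmem s) (hmem t)) (hmem z)⟩
  have h2' : KZ.of z - KZ.of z - KZ.of z ∈ KZ.relationsLE j :=
    KZ.movesLE_subset_relationsLE j
      ⟨Or.inl (Or.inl (Or.inr h2)), sub_mem (sub_mem (hmem z) (hmem z)) (hmem z)⟩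
  have e : KZ.of s - KZ.of t = (KZ.of s - KZ.of t - KZ.of z) - (KZ.of z - KZ.of z - KZ.of z) := by
    abel
  rw [e]
  exact sub_mem h1' h2'

/-- **`BudgetThesisOfSubs`** (route DimensionBudget, stmt-KontsevichZagierPeriods-18188):
`CubeNashNormalForm → CubicalKernelWithinOne → BudgetThesis`. Given KZ-rational `r`, `r'` with equal
values: compile `[r] − [r']` to a `ℤ`-combination `x` of cube–Nash representations
(`CubeNashNormalForm`); replace each by its tame version inside its own dimension
(`exists_isTameCube_sub_mem_relationsLE`), getting `y` in the tame cubical span of dimension `≤ K` (the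
top dimension of the cubes) with `x − y ∈ relationsLE K`; by soundness of the calculus
(`KZ.relations_le_ker_eval_holds`) `eval y = eval x = eval ([r] − [r']) = 0`; the cubical kernel
budget puts `y` in `relationsLE (K + 1)`; exhaustion (`KZ.mem_relations_iff_exists_mem_relationsLE`)
puts the compilation relation in some `relationsLE d₁`; monotonicity gives
`[r] − [r'] ∈ relationsLE (max d₁ (K+1))`, which is `BudgetThesis` (its inlined truncation is
`KZ.relationsLE` by `rfl`). [folklore] -/
theorem budgetThesisOfSubs_proof :
    Summit.KontsevichZagierPeriods.KontsevichZagierPeriods.Theses.DimensionBudget.BudgetThesisOfSubs := by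
  intro h₁ h₂ n m r r' hr hr' hv
  obtain ⟨S, nn, g, U, ε, s, hgen, hs, hrel⟩ := h₁ n m r r' hr hr'
  -- tame versions of the compiled cube–Nash representations, one move (1b) away in their own dimension
  have htame : ∀ i, ∃ t : KZ.IntegralRep (nn i), t.IsTameCube ∧
      KZ.of (s i) - KZ.of t ∈ KZ.relationsLE (nn i) := fun i =>
    exists_isTameCube_sub_mem_relationsLE (s i) (g i) (U i) (hgen i).2.1 (hgen i).2.2.1
      (hgen i).2.2.2 (hs i).1 (hs i).2
  choose t ht hst using htame
  -- the top dimension of the cubes, the compiled combination `x` and its tame version `y`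
  set K : ℕ := Finset.univ.sup nn with hK
  set x : KZ.FormalRep := ∑ i, ε i • KZ.of (s i) with hx
  set y : KZ.FormalRep := ∑ i, ε i • KZ.of (t i) with hy
  -- (1) `y` lies in the tame cubical span of dimension `≤ K`
  have hymem : y ∈ AddSubgroup.closure {w : KZ.FormalRep | ∃ (j : ℕ) (u : KZ.IntegralRep j),
      j ≤ K ∧ u.IsTameCube ∧ w = KZ.of u} := by
    refine AddSubgroup.sum_mem _ fun i _ => AddSubgroup.zsmul_mem _ (AddSubgroup.subset_closure ?_) _
    exact ⟨nn i, t i, Finset.le_sup (Finset.mem_univ i), ht i, rfl⟩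
  -- (2) `x − y` is a truncated relation inside dimension `K`
  have hxy : x - y ∈ KZ.relationsLE K := by
    rw [hx, hy, ← Finset.sum_sub_distrib]
    refine AddSubgroup.sum_mem _ fun i _ => ?_
    rw [← zsmul_sub]
    exact AddSubgroup.zsmul_mem _ (KZ.relationsLE_mono (Finset.le_sup (Finset.mem_univ i)) (hst i)) _
  -- (3) soundness of the calculus: `x`, hence `y`, evaluates to `0`
  have hker : KZ.relations ≤ KZ.eval.ker := KZ.relations_le_ker_eval_holds
  have h0 : KZ.eval (KZ.of r - KZ.of r' - x) = 0 := AddMonoidHom.mem_ker.mp (hker hrel)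
  have hrr' : KZ.eval (KZ.of r - KZ.of r') = 0 := by
    rw [map_sub, KZ.eval_of, KZ.eval_of, hv, sub_self]
  have hx0 : KZ.eval x = 0 := by
    rw [map_sub, hrr', zero_sub, neg_eq_zero] at h0
    exact h0
  have hxy0 : KZ.eval (x - y) = 0 :=
    AddMonoidHom.mem_ker.mp (hker (KZ.relationsLE_le_relations K hxy))
  have hy0 : KZ.eval y = 0 := by
    rw [map_sub, hx0, zero_sub, neg_eq_zero] at hxy0
    exact hxy0
  -- (4) the route's budget statement on the cubical sector
  have hy1 : y ∈ KZ.relationsLE (K + 1) := h₂ K y hymem hy0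
  -- (5) exhaustion for the compilation relation, then monotonicity of the truncation
  obtain ⟨d₁, hd₁⟩ := KZ.mem_relations_iff_exists_mem_relationsLE.mp hrel
  refine ⟨max d₁ (K + 1), ?_⟩
  change KZ.of r - KZ.of r' ∈ KZ.relationsLE (max d₁ (K + 1))
  have e : KZ.of r - KZ.of r' = (KZ.of r - KZ.of r' - x) + (x - y) + y := by abel
  rw [e]
  exact add_mem (add_mem (KZ.relationsLE_mono (le_max_left _ _) hd₁)
    (KZ.relationsLE_mono ((Nat.le_succ K).trans (le_max_right _ _)) hxy))
    (KZ.relationsLE_mono (le_max_right _ _) hy1)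

end Summit.KontsevichZagierPeriods.DimensionBudget
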